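import Summits.Ventures.PercRepro.SevenThreeStarGuard
import Summits.Ventures.PercRepro.SevenThreeStarApply

/-!
# PercRepro — the `(7,3)` cell: THE STAR FIBRE BOUND (p3, gen 16)

The series classes of the cyclic part `K_N` of a star fibre, sorted by decreasing size (`classList`), padded with
zeros to length `9` (`csPad`), form a REALISABLE datum of the star table (`realisable_csPad`: the class bounds of
`SevenThreeStarGuard.lean` are exactly the guard), so the table applies (`starTable_at`, `cellOK_spec`): the fibre has
exact divisions and `starBound ℓ₀ ≤ deltaStarN`. With `star_fibre_sum` this gives **`star_fibre_bound`**: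
`Σ_{fibre of N} bracket ≥ starBound ℓ₀ / Ls` — `≥ 0` for `ℓ₀ ≤ 2` and `≥ 3827/94900` at `ℓ₀ = 3`, the star minima
of mine-2's §27.3 in the kernel (`P3-C025-seven-three-plan.md` §9 (R3)(b), (R4)).
-/

namespace PercRepro

namespace SevenThree

open Finset ThmH SixThree StarApply

variable {α : Type*} [DecidableEq α] {M : Matroid α} [M.Finite]

/-- The series classes of `K`, sorted by decreasing size. -/
noncomputable def classList (M : Matroid α) [M.Finite] (K : Finset α) : List (Finset α) :=
  (serClasses M K).toList.mergeSort (fun a b => decide (b.card ≤ a.card))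

/-- `classList` is a permutation of the list of classes. -/
theorem classList_perm (K : Finset α) : (classList M K).Perm (serClasses M K).toList :=
  List.mergeSort_perm _ _

/-- `classList` is a class list. -/
theorem isClassList_classList (K : Finset α) : IsClassList M K (classList M K) :=
  ⟨(classList_perm K).nodup_iff.2 (Finset.nodup_toList _),
    by rw [List.toFinset_eq_of_perm _ _ (classList_perm K), Finset.toList_toFinset]⟩

/-- `classList` is sorted by decreasing size. -/
theorem classList_sorted (K : Finset α) : (classList M K).Pairwise (fun a b => b.card ≤ a.card) := by
  have := List.pairwise_mergeSort (le := fun a b : Finset α => decide (b.card ≤ a.card))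
    (by
      intro a b c hab hbc
      simp only [decide_eq_true_iff] at hab hbc ⊢
      omega)
    (by
      intro a b
      by_cases hab : b.card ≤ a.card
      · simp [hab]
      · simp only [Bool.or_eq_true, decide_eq_true_iff]
        omega)
    (serClasses M K).toList
  exact this.imp (fun hh => decide_eq_true_iff.1 hh)

/-- The class sizes, padded with zeros to length `9`. -/
noncomputable def csPad (M : Matroid α) [M.Finite] (K : Finset α) : List ℕ :=
  (classList M K).map Finset.card ++ List.replicate (9 - ((classList M K).map Finset.card).length) 0

/-- A list sum over the class list is the finset sum over the classes (natural numbers). -/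
theorem list_sum_classList_nat {K : Finset α} (f : Finset α → ℕ) :
    ((classList M K).map f).sum = ∑ N ∈ serClasses M K, f N := by
  rw [← (isClassList_classList K).2, List.sum_toFinset f (isClassList_classList K).1]

/-- `(csPad.map g).sum = Σ_N g |N| + (9 − #classes) · g 0`. -/
theorem sum_map_csPad {K : Finset α} (g : ℕ → ℕ) :
    ((csPad M K).map g).sum = ∑ N ∈ serClasses M K, g N.card +
      (9 - ((classList M K).map Finset.card).length) * g 0 := by
  unfold csPad
  rw [List.map_append, List.sum_append, List.map_replicate, List.sum_replicate, smul_eq_mul, List.map_map]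
  congr 1
  rw [← list_sum_classList_nat (fun N => g N.card)]
  rfl

/-- The number of classes is at most `|K|`. -/
theorem card_serClasses_le (K : Finset α) : (serClasses M K).card ≤ K.card :=
  (Finset.card_image_le).trans (Finset.card_le_card (cyclicPart_subset M K))

/-- The length of the class list is the number of classes. -/
theorem length_classList (K : Finset α) : (classList M K).length = (serClasses M K).card := by
  rw [(classList_perm K).length_eq, Finset.length_toList]

/-- `csPad` has length `9` when there are at most `9` classes. -/
theorem length_csPad {K : Finset α} (hK : (serClasses M K).card ≤ 9) : (csPad M K).length = 9 := by
  unfold csPad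
  rw [List.length_append, List.length_replicate, List.length_map, length_classList]
  omega

/-- `csPad` is descending with head `≤ 9` when every class has at most `9` points. -/
theorem desc_csPad {K : Finset α} (hK : K.card ≤ 9) : Desc 9 (csPad M K) := by
  apply desc_of_pairwise
  · intro x hx
    unfold csPad at hx
    rw [List.mem_append, List.mem_map] at hx
    rcases hx with ⟨N, hN, rfl⟩ | hx
    · obtain ⟨e, -, rfl⟩ := mem_serClasses.1 (mem_serClasses_of_mem_classList (isClassList_classList K) hN)
      exact (Finset.card_le_card ((serClass_subset K e).trans (cyclicPart_subset M K))).trans hK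
    · rw [List.mem_replicate] at hx
      omega
  · unfold csPad
    rw [List.pairwise_append]
    refine ⟨?_, ?_, ?_⟩
    · rw [List.pairwise_map]
      exact classList_sorted K
    · exact List.pairwise_replicate.2 (Or.inr (le_refl 0))
    · intro a _ b hb
      rw [List.mem_replicate] at hb
      omega

/-- A class of `K` (coloop-free) lies in `K`, so its size is at most `|K|`: a wrapper for `card_le_of_mem_serClasses`. -/
theorem card_le_of_mem_serClasses' {K N : Finset α} (hcf : cyclicPart M K = K) (hN : N ∈ serClasses M K) :
    N.card ≤ K.card := card_le_of_mem_serClasses hcf hN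

/-- The classes partition `K ∩ T`: `Σ_N |N ∩ T| = |K ∩ T|` (coloop-free `K`). -/
theorem sum_card_inter_classes {K A : Finset α} (hK : K ⊆ gr M) (hcf : cyclicPart M K = K) :
    ∑ N ∈ serClasses M K, (N ∩ A).card = (K ∩ A).card := by
  have h1 : (serClasses M K).biUnion (fun N => N ∩ A) = K ∩ A := by
    rw [← Finset.biUnion_inter]
    change (serClasses M K).biUnion id ∩ A = K ∩ A
    rw [biUnion_serClasses, hcf]
  rw [← h1, Finset.card_biUnion]
  intro N hN N' hN' hne
  rw [Finset.mem_coe] at hN hN'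
  have := pairwiseDisjoint_serClasses hK hN hN' hne
  rw [Function.onFun, id, id] at this
  rw [Function.onFun]
  exact this.mono Finset.inter_subset_left Finset.inter_subset_left

/-- The sizes of `K_N`, `K_N ∩ T`, `K_N ∩ W` for a star: `|K_N| = 10 − t_P − c_P − ℓ₀`, `|K_N ∩ T| = 3 − t_P`,
`|K_N ∩ W| = 7 − c_P − ℓ₀`. -/
theorem kN_sizes {T W N : Finset α} (h : ReducedWorld M T W) (hr : M.eRank = 7) (hN : N ∈ serClasses M (T ∪ W)) :
    ((T ∪ W) \ (N ∪ coloopsOf M (T ∪ W))).card + (N ∩ T).card + (N ∩ W).card + (coloopsOf M (T ∪ W)).card = 10 ∧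
      (((T ∪ W) \ (N ∪ coloopsOf M (T ∪ W))) ∩ T).card + (N ∩ T).card = 3 ∧
      (((T ∪ W) \ (N ∪ coloopsOf M (T ∪ W))) ∩ W).card + (N ∩ W).card + (coloopsOf M (T ∪ W)).card = 7 := by
  have hLW := coloopsOf_world_subset h hr
  have hNcard := card_serClass_split h hN
  have h10 := card_kN h hN
  refine ⟨by omega, ?_, ?_⟩
  · have hKT : ((T ∪ W) \ (N ∪ coloopsOf M (T ∪ W))) ∩ T = T \ (N ∩ T) := by
      ext e
      simp only [Finset.mem_inter, Finset.mem_sdiff, Finset.mem_union, not_or]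
      constructor
      · rintro ⟨⟨-, hN', -⟩, hT⟩
        exact ⟨hT, fun hh => hN' hh.1⟩
      · rintro ⟨hT, hh⟩
        exact ⟨⟨Or.inl hT, fun hN' => hh ⟨hN', hT⟩, fun hL => Finset.disjoint_left.1 h.disj hT (hLW hL)⟩, hT⟩
    rw [hKT, Finset.card_sdiff_of_subset Finset.inter_subset_right, h.T_card]
    have := Finset.card_le_card (Finset.inter_subset_right : N ∩ T ⊆ T)
    rw [h.T_card] at this
    omega
  · have hKW : ((T ∪ W) \ (N ∪ coloopsOf M (T ∪ W))) ∩ W = W \ ((N ∩ W) ∪ coloopsOf M (T ∪ W)) := by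
      ext e
      simp only [Finset.mem_inter, Finset.mem_sdiff, Finset.mem_union, not_or]
      constructor
      · rintro ⟨⟨-, hN', hL⟩, hW⟩
        exact ⟨hW, fun hh => hN' hh.1, hL⟩
      · rintro ⟨hW, hh, hL⟩
        exact ⟨⟨Or.inr hW, fun hN' => hh ⟨hN', hW⟩, hL⟩, hW⟩
    have hsub : (N ∩ W) ∪ coloopsOf M (T ∪ W) ⊆ W := Finset.union_subset Finset.inter_subset_right hLW
    have hdisj : Disjoint (N ∩ W) (coloopsOf M (T ∪ W)) :=
      (disjoint_serClass_coloops hN).mono_left Finset.inter_subset_left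
    rw [hKW, Finset.card_sdiff_of_subset hsub, Finset.card_union_of_disjoint hdisj, h.W_card]
    have := Finset.card_le_card hsub
    rw [Finset.card_union_of_disjoint hdisj, h.W_card] at this
    omega

/-- The per-class arithmetic of a star: for a class `N_i` of `K_N`, `|N_i ∩ T| ≤ 2 − t_P`,
`|N_i ∩ W| + c_P + ℓ₀ ≤ 5`, `|N_i| = |N_i ∩ T| + |N_i ∩ W|`. -/
theorem class_arith {T W N Ni : Finset α} (h : ReducedWorld M T W) (hr : M.eRank = 7)
    (hN : N ∈ serClasses M (T ∪ W)) (hNW : (N ∩ W).Nonempty)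
    (hNi : Ni ∈ serClasses M ((T ∪ W) \ (N ∪ coloopsOf M (T ∪ W)))) :
    (Ni ∩ T).card + (N ∩ T).card ≤ 2 ∧ (Ni ∩ W).card + (N ∩ W).card + (coloopsOf M (T ∪ W)).card ≤ 5 ∧
      Ni.card = (Ni ∩ T).card + (Ni ∩ W).card := by
  obtain ⟨hKg, hK2, hcf⟩ := kN_facts h hr hN hNW
  obtain ⟨h3, h2, h1⟩ := class_bounds h hr hN hNW hNi
  obtain ⟨-, hKT, hKW⟩ := kN_sizes h hr hN
  set K := (T ∪ W) \ (N ∪ coloopsOf M (T ∪ W)) with hKdef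
  have hNiK : Ni ⊆ K := by
    obtain ⟨e, -, rfl⟩ := mem_serClasses.1 hNi
    exact (serClass_subset K e).trans (by rw [hcf])
  have hNiE : Ni ⊆ T ∪ W := hNiK.trans Finset.sdiff_subset
  have hsplitT : ((K \ Ni) ∩ T).card + (Ni ∩ T).card = (K ∩ T).card := by
    rw [← Finset.card_union_of_disjoint (Finset.disjoint_left.2 (fun e he he' =>
      (Finset.mem_sdiff.1 (Finset.mem_inter.1 he).1).2 (Finset.mem_inter.1 he').1))]
    congr 1
    ext e
    simp only [Finset.mem_union, Finset.mem_inter, Finset.mem_sdiff]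
    constructor
    · rintro (⟨⟨hK, -⟩, hT⟩ | ⟨hNi', hT⟩)
      · exact ⟨hK, hT⟩
      · exact ⟨hNiK hNi', hT⟩
    · rintro ⟨hK, hT⟩
      by_cases hh : e ∈ Ni
      · exact Or.inr ⟨hh, hT⟩
      · exact Or.inl ⟨⟨hK, hh⟩, hT⟩
  have hsplitW : ((K \ Ni) ∩ W).card + (Ni ∩ W).card = (K ∩ W).card := by
    rw [← Finset.card_union_of_disjoint (Finset.disjoint_left.2 (fun e he he' =>
      (Finset.mem_sdiff.1 (Finset.mem_inter.1 he).1).2 (Finset.mem_inter.1 he').1))]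
    congr 1
    ext e
    simp only [Finset.mem_union, Finset.mem_inter, Finset.mem_sdiff]
    constructor
    · rintro (⟨⟨hK, -⟩, hW⟩ | ⟨hNi', hW⟩)
      · exact ⟨hK, hW⟩
      · exact ⟨hNiK hNi', hW⟩
    · rintro ⟨hK, hW⟩
      by_cases hh : e ∈ Ni
      · exact Or.inr ⟨hh, hW⟩
      · exact Or.inl ⟨⟨hK, hh⟩, hW⟩
  have hNisplit : Ni.card = (Ni ∩ T).card + (Ni ∩ W).card := by
    rw [← Finset.card_union_of_disjoint (h.disj.mono Finset.inter_subset_right Finset.inter_subset_right)]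
    congr 1
    ext e
    simp only [Finset.mem_union, Finset.mem_inter]
    constructor
    · intro he
      rcases Finset.mem_union.1 (hNiE he) with hh | hh
      · exact Or.inl ⟨he, hh⟩
      · exact Or.inr ⟨he, hh⟩
    · rintro (⟨he, -⟩ | ⟨he, -⟩) <;> exact he
  exact ⟨by omega, by omega, hNisplit⟩

/-- `K_N` has at least two series classes. -/
theorem two_le_card_serClasses_kN {T W N : Finset α} (h : ReducedWorld M T W) (hr : M.eRank = 7)
    (hN : N ∈ serClasses M (T ∪ W)) (hNW : (N ∩ W).Nonempty) :
    2 ≤ (serClasses M ((T ∪ W) \ (N ∪ coloopsOf M (T ∪ W)))).card := by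
  obtain ⟨hKg, hK2, hcf⟩ := kN_facts h hr hN hNW
  obtain ⟨h10, -, -⟩ := kN_sizes h hr hN
  have htP := card_inter_T_le_one h hr hN
  have hflat := card_inter_add_card_coloops_le h hr hN hNW
  set K := (T ∪ W) \ (N ∪ coloopsOf M (T ∪ W)) with hKdef
  have hsum := sum_card_serClasses hKg (A := K)
  rw [hcf] at hsum
  have hKpos : 3 ≤ K.card := by omega
  by_contra hlt
  rcases Nat.lt_or_ge (serClasses M K).card 1 with h0 | h1
  · rw [Finset.card_eq_zero.1 (by omega : (serClasses M K).card = 0), Finset.sum_empty] at hsum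
    omega
  · obtain ⟨Ni, hNi⟩ := Finset.card_eq_one.1 (by omega : (serClasses M K).card = 1)
    rw [hNi, Finset.sum_singleton] at hsum
    have := (class_bounds h hr hN hNW (by rw [hNi]; exact Finset.mem_singleton_self Ni)).1
    have hNiK : Ni ⊆ K := by
      obtain ⟨e, -, rfl⟩ := mem_serClasses.1 (by rw [hNi]; exact Finset.mem_singleton_self Ni :
        Ni ∈ serClasses M K)
      exact (serClass_subset K e).trans (by rw [hcf])
    rw [Finset.card_sdiff_of_subset hNiK] at this
    omega

/-- **The realisability of the datum of a star**: `csPad` of `K_N` passes the guard. -/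
theorem realisable_csPad {T W N : Finset α} (h : ReducedWorld M T W) (hr : M.eRank = 7)
    (hN : N ∈ serClasses M (T ∪ W)) (hNW : (N ∩ W).Nonempty) :
    StarTable.realisable (N ∩ T).card (N ∩ W).card (coloopsOf M (T ∪ W)).card
      (csPad M ((T ∪ W) \ (N ∪ coloopsOf M (T ∪ W)))) = true := by
  obtain ⟨hKg, hK2, hcf⟩ := kN_facts h hr hN hNW
  obtain ⟨h10, hKT, hKW⟩ := kN_sizes h hr hN
  have hflat := card_inter_add_card_coloops_le h hr hN hNW
  have htP := card_inter_T_le_one h hr hN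
  have hcP : 1 ≤ (N ∩ W).card := Finset.card_pos.2 hNW
  have hcls := two_le_card_serClasses_kN h hr hN hNW
  have harith := fun Ni hNi => class_arith h hr hN hNW (Ni := Ni) hNi
  set K := (T ∪ W) \ (N ∪ coloopsOf M (T ∪ W)) with hKdef
  have hsumK := sum_card_serClasses hKg (A := K)
  rw [hcf] at hsumK
  have hsumT := sum_card_inter_classes (A := T) hKg hcf
  simp only [StarTable.realisable, decide_eq_true_iff]
  refine ⟨hcP, by omega, ?_, ?_, ?_, ?_, ?_⟩
  · -- the sum of the sizes
    have := sum_map_csPad (M := M) (K := K) id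
    rw [List.map_id] at this
    rw [this]
    simp only [id]
    omega
  · -- at least two nonzero classes
    unfold csPad
    rw [List.filter_append, List.length_append]
    have hzero : (List.replicate (9 - ((classList M K).map Finset.card).length) 0).filter
        (fun n => decide (1 ≤ n)) = [] := by
      rw [List.filter_eq_nil_iff]
      intro n hn
      rw [List.mem_replicate] at hn
      simp [hn.2]
    have hall : ((classList M K).map Finset.card).filter (fun n => decide (1 ≤ n)) =
        (classList M K).map Finset.card := by
      rw [List.filter_eq_self]
      intro n hn
      rw [List.mem_map] at hn
      obtain ⟨Ni, hNi, rfl⟩ := hn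
      have := nonempty_of_mem_serClasses (mem_serClasses_of_mem_classList (isClassList_classList K) hNi)
      simp only [decide_eq_true_iff]
      exact Finset.card_pos.2 this
    rw [hzero, hall, List.length_nil, List.length_map, length_classList]
    omega
  · -- every excess is at most `2 − t_P`
    rw [List.all_eq_true]
    intro x hx
    rw [List.mem_map] at hx
    obtain ⟨n, hn, rfl⟩ := hx
    rw [decide_eq_true_iff]
    unfold csPad at hn
    rw [List.mem_append, List.mem_map] at hn
    rcases hn with ⟨Ni, hNi, rfl⟩ | hn
    · obtain ⟨ha, hb, hc⟩ := harith Ni (mem_serClasses_of_mem_classList (isClassList_classList K) hNi)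
      omega
    · rw [List.mem_replicate] at hn
      omega
  · -- the total excess is at most `3 − t_P`
    rw [sum_map_csPad, Nat.zero_sub, mul_zero, add_zero]
    have : ∑ Ni ∈ serClasses M K, (Ni.card - (5 - (N ∩ W).card - (coloopsOf M (T ∪ W)).card)) ≤
        ∑ Ni ∈ serClasses M K, (Ni ∩ T).card := by
      apply Finset.sum_le_sum
      intro Ni hNi
      obtain ⟨ha, hb, hc⟩ := harith Ni hNi
      omega
    rw [hsumT] at this
    omega
  · -- the capped sizes reach `3 − t_P`
    rw [sum_map_csPad, Nat.zero_min, mul_zero, add_zero]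
    have : ∑ Ni ∈ serClasses M K, (Ni ∩ T).card ≤
        ∑ Ni ∈ serClasses M K, min Ni.card (2 - (N ∩ T).card) := by
      apply Finset.sum_le_sum
      intro Ni hNi
      obtain ⟨ha, hb, hc⟩ := harith Ni hNi
      omega
    rw [hsumT] at this
    omega

/-- **THE STAR FIBRE BOUND**: `Σ_{fibre of N} bracket ≥ starBound ℓ₀ / Ls`. -/
theorem star_fibre_bound {T W N : Finset α} (h : ReducedWorld M T W) (hr : M.eRank = 7)
    (hN : N ∈ serClasses M (T ∪ W)) (hNW : (N ∩ W).Nonempty) :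
    ((StarTable.starBound (coloopsOf M (T ∪ W)).card : ℤ) : ℚ) / (StarTable.Ls : ℚ) ≤
      ∑ X ∈ W.powerset.filter (fun X => (W \ X) \ coloopsOf M (T ∪ W) ⊆ N ∧
        ((W \ X) \ coloopsOf M (T ∪ W)).Nonempty), bracket M T X := by
  obtain ⟨hKg, hK2, hcf⟩ := kN_facts h hr hN hNW
  obtain ⟨h10, hKT, hKW⟩ := kN_sizes h hr hN
  have hflat := card_inter_add_card_coloops_le h hr hN hNW
  have htP := card_inter_T_le_one h hr hN
  have hl0 := card_coloopsOf_world_le h hr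
  have hcP : 1 ≤ (N ∩ W).card := Finset.card_pos.2 hNW
  set K := (T ∪ W) \ (N ∪ coloopsOf M (T ∪ W)) with hKdef
  have hK9 : K.card ≤ 9 := by omega
  have hcls9 : (serClasses M K).card ≤ 9 := (card_serClasses_le K).trans hK9
  have hsumK := sum_card_serClasses hKg (A := K)
  rw [hcf] at hsumK
  have hsum : (csPad M K).sum ≤ 10 - (N ∩ T).card - (N ∩ W).card - (coloopsOf M (T ∪ W)).card := by
    have := sum_map_csPad (M := M) (K := K) id
    rw [List.map_id] at this
    rw [this]
    simp only [id]
    omega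
  have hcell := starTable_at htP hl0 (by omega) (length_csPad hcls9) (desc_csPad hK9) hsum
  obtain ⟨hdiv, hbound⟩ := cellOK_spec hcell (realisable_csPad h hr hN hNW)
  unfold csPad at hdiv hbound
  rw [divOK_append_zeros] at hdiv
  rw [deltaStarN_append_zeros] at hbound
  rw [star_fibre_sum h hr hN (isClassList_classList K) hdiv]
  have hLs : (0 : ℚ) < (StarTable.Ls : ℚ) := by exact_mod_cast Ls_pos
  rw [div_le_div_iff_of_pos_right hLs]
  exact_mod_cast hbound

end SevenThree

end PercRepro
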